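import Literature.Probability.Percolation.LatticeBoundaryConnectivity
import Literature.Probability.Percolation.SemicircuitDomain
import Literature.Probability.LatticeModels.ThermodynamicLimit
import HarnessLib

/-!
# Half-annulus duality for the matching pair `(ℤ², ℤ²∗)`

Topic `Probability/Percolation`. The planar duality statement behind "if there is no infinite
`+`cluster in the upper half-plane then every finite subset of the upper half-plane is surrounded
by a `−∗`semicircuit" (Georgii–Higuchi 2000, proofs of Lemma 3.1 Step 1, Lemma 3.4, Lemma 4.1 and
Lemma 5.5 Case 1; Russo 1979), in a finite form: in the upper half `Λ_N ∩ {x₂ ≥ 0}` of a box, with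
window `Λ_n ∩ {x₂ ≥ 0}`, `n < N`, and a set `O` of "occupied" sites, **either** there is a lattice
walk of unoccupied sites in the upper half-annulus from a site adjacent to the window to a site on
the border layer `{|x_i| = N}`, **or** there is a `∗`-walk of occupied sites in the upper
half-annulus from the left half-axis to the right half-axis (a `∗`semicircuit around the window)
(`exists_starSemicircuit_or_latticeEscape`).

Proof: symmetrise by the fold `x ↦ (x₁, |x₂|)`; let `C` be the border ring `{‖x‖_∞ = N+1}` together
with the unoccupied lattice clusters of the (symmetric) annulus attached to it; by the
Deuschel–Pisztora/Timár theorem `exists_starWalk_latticeBoundary` the boundary of `C` visible from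
the origin is `∗`-connected; it consists of occupied annulus sites, is symmetric, and contains an
axis site on each side of the window; folding the `∗`-walk joining them into the upper half-plane
gives the semicircuit.

## References

* H.-O. Georgii, Y. Higuchi, J. Math. Phys. 41 (2000), §§3–5 [GeorgiiHiguchi2000].
* L. Russo, *The infinite cluster method in the two-dimensional Ising model*, CMP 67 (1979) [Russo1979].
* Á. Timár, Proc. AMS 141 (2013), Theorem 2 [Timar2013].
-/

noncomputable section

open SimpleGraph Finset
open Literature.Probability.LatticeModels

namespace Literature.Probability.Percolation

/-! ### The fold `x ↦ (x₁, |x₂|)` -/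

/-- The fold into the closed upper half-plane. [folklore] -/
def foldSite (z : Site 2) : Site 2 := fun i => if i = 1 then |z 1| else z i

/-- Coordinates of the fold. [folklore] -/
@[simp] theorem foldSite_apply_zero (z : Site 2) : foldSite z 0 = z 0 := by simp [foldSite]

/-- Coordinates of the fold. [folklore] -/
@[simp] theorem foldSite_apply_one (z : Site 2) : foldSite z 1 = |z 1| := by simp [foldSite]

/-- The fold fixes the closed upper half-plane. [folklore] -/
theorem foldSite_of_nonneg {z : Site 2} (hz : 0 ≤ z 1) : foldSite z = z := by
  funext i; fin_cases i
  · exact foldSite_apply_zero z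
  · change foldSite z 1 = z 1; rw [foldSite_apply_one, abs_of_nonneg hz]

/-- The fold is invariant under the reflection. [folklore] -/
theorem foldSite_Rf (z : Site 2) : foldSite (Rf z) = foldSite z := by
  funext i; fin_cases i
  · change foldSite (Rf z) 0 = foldSite z 0; rw [foldSite_apply_zero, foldSite_apply_zero, Rf_apply_zero]
  · change foldSite (Rf z) 1 = foldSite z 1; rw [foldSite_apply_one, foldSite_apply_one, Rf_apply_one, abs_neg]

/-- The fold is idempotent. [folklore] -/
theorem foldSite_foldSite (z : Site 2) : foldSite (foldSite z) = foldSite z :=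
  foldSite_of_nonneg (by rw [foldSite_apply_one]; exact abs_nonneg _)

/-- The fold of a site is the site or its reflection. [folklore] -/
theorem foldSite_eq_or (z : Site 2) : foldSite z = z ∨ foldSite z = Rf z := by
  rcases le_or_gt 0 (z 1) with h | h
  · exact Or.inl (foldSite_of_nonneg h)
  · right; rw [← foldSite_Rf]; exact foldSite_of_nonneg (by rw [Rf_apply_one]; omega)

/-- The fold preserves `∗`-adjacency (it is `1`-Lipschitz in each coordinate and never identifies
`∗`-neighbours). [folklore] -/
def starFoldHom : zdStarGraph →g zdStarGraph where
  toFun := foldSite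
  map_rel' := fun {a b} hab => by
    rw [zdStarGraph_adj_iff] at hab ⊢
    obtain ⟨hne, h0, h1⟩ := hab
    simp only [foldSite_apply_zero, foldSite_apply_one]
    rw [abs_le] at h0 h1
    refine ⟨?_, by rw [abs_le]; omega, by
      rw [abs_le]; rcases abs_cases (a 1) with ⟨ha, ha'⟩ | ⟨ha, ha'⟩ <;>
        rcases abs_cases (b 1) with ⟨hb, hb'⟩ | ⟨hb, hb'⟩ <;> rw [ha, hb] <;> omega⟩
    rcases hne with hne | hne
    · exact Or.inl hne
    · right
      rcases abs_cases (a 1) with ⟨ha, ha'⟩ | ⟨ha, ha'⟩ <;>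
        rcases abs_cases (b 1) with ⟨hb, hb'⟩ | ⟨hb, hb'⟩ <;> rw [ha, hb] <;> omega

/-- `starFoldHom` acts by `foldSite`. [folklore] -/
@[simp] theorem starFoldHom_apply (z : Site 2) : starFoldHom z = foldSite z := rfl

/-- The fold preserves lattice adjacency. [folklore] -/
def latticeFoldHom : zdGraph 2 →g zdGraph 2 where
  toFun := foldSite
  map_rel' := fun {a b} hab => by
    rw [zdGraph_two_adj_iff] at hab ⊢
    simp only [foldSite_apply_zero, foldSite_apply_one]
    rcases hab with ⟨h0, h1⟩ | ⟨h0, h1⟩ | ⟨h1, h0⟩ | ⟨h1, h0⟩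
    · exact Or.inl ⟨h0, by rw [h1]⟩
    · exact Or.inr (Or.inl ⟨h0, by rw [h1]⟩)
    · rcases abs_cases (a 1) with ⟨ha, ha'⟩ | ⟨ha, ha'⟩ <;>
        rcases abs_cases (b 1) with ⟨hb, hb'⟩ | ⟨hb, hb'⟩ <;> rw [ha, hb] <;> omega
    · rcases abs_cases (a 1) with ⟨ha, ha'⟩ | ⟨ha, ha'⟩ <;>
        rcases abs_cases (b 1) with ⟨hb, hb'⟩ | ⟨hb, hb'⟩ <;> rw [ha, hb] <;> omega

/-- `latticeFoldHom` acts by `foldSite`. [folklore] -/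
@[simp] theorem latticeFoldHom_apply (z : Site 2) : latticeFoldHom z = foldSite z := rfl

/-- Vertices of a mapped walk. [folklore] -/
theorem mem_support_map_iff' {V W : Type*} {G : SimpleGraph V} {G' : SimpleGraph W} (f : G →g G')
    {u v : V} (w : G.Walk u v) (z : W) : z ∈ (w.map f).support ↔ ∃ y ∈ w.support, f y = z := by
  rw [Walk.support_map, List.mem_map]

/-! ### The border ring -/

/-- The ring `{‖x‖_∞ = M}`. [folklore] -/
def OnRing (M : ℕ) (z : Site 2) : Prop := (|z 0| = M ∧ |z 1| ≤ M) ∨ (|z 1| = M ∧ |z 0| ≤ M)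

/-- The corner `(M, M)`. [folklore] -/
def ringCorner (M : ℕ) : Site 2 := fun _ => (M : ℤ)

/-- Vertices of a straight run (coordinates). [folklore] -/
theorem mem_support_stepRun_iff {s : Site 2} {hs : ∀ x : Site 2, (zdGraph 2).Adj x (x + s)} {z w : Site 2} {k : ℕ} :
    w ∈ (Zhang.stepRun s hs z k).support ↔ ∃ j : ℕ, j ≤ k ∧ w 0 = z 0 + j * s 0 ∧ w 1 = z 1 + j * s 1 :=
  Zhang.mem_support_stepRun

/-- An up-run inside the ring along the right or left side, ending at the top. [folklore] -/
theorem exists_walk_onRing_vertical {M : ℕ} {z : Site 2} (hz0 : |z 0| = M) (hz1 : |z 1| ≤ M) :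
    ∃ (t : Site 2) (q : (zdGraph 2).Walk z t), t 0 = z 0 ∧ t 1 = M ∧ ∀ v ∈ q.support, OnRing M v := by
  set k : ℕ := ((M : ℤ) - z 1).toNat with hk
  have hk' : (k : ℤ) = M - z 1 := by rw [hk, Int.toNat_of_nonneg (by rw [abs_le] at hz1; omega)]
  refine ⟨_, Zhang.stepRun (Pi.single 1 1) Zhang.adj_add_unitStep.2.2.1 z k, ?_, ?_, fun v hv => ?_⟩
  · rw [Zhang.iterate_add_apply]; simp
  · rw [Zhang.iterate_add_apply]; simp; omega
  · rw [mem_support_stepRun_iff] at hv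
    obtain ⟨j, hj, h0, h1⟩ := hv
    simp at h0 h1
    left; refine ⟨by rw [h0]; exact hz0, ?_⟩
    rw [abs_le] at hz1 ⊢; constructor <;> omega
/-- A right-run inside the ring along the top or bottom side, ending at the right side. [folklore] -/
theorem exists_walk_onRing_horizontal {M : ℕ} {z : Site 2} (hz1 : |z 1| = M) (hz0 : |z 0| ≤ M) :
    ∃ (t : Site 2) (q : (zdGraph 2).Walk z t), t 1 = z 1 ∧ t 0 = M ∧ ∀ v ∈ q.support, OnRing M v := by
  set k : ℕ := ((M : ℤ) - z 0).toNat with hk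
  have hk' : (k : ℤ) = M - z 0 := by rw [hk, Int.toNat_of_nonneg (by rw [abs_le] at hz0; omega)]
  refine ⟨_, Zhang.stepRun (Pi.single 0 1) Zhang.adj_add_unitStep.1 z k, ?_, ?_, fun v hv => ?_⟩
  · rw [Zhang.iterate_add_apply]; simp
  · rw [Zhang.iterate_add_apply]; simp; omega
  · rw [mem_support_stepRun_iff] at hv
    obtain ⟨j, hj, h0, h1⟩ := hv
    simp at h0 h1
    right; refine ⟨by rw [h1]; exact hz1, ?_⟩
    rw [abs_le] at hz0 ⊢; constructor <;> omega

/-- Every ring site is joined inside the ring to the corner `(M, M)`. [folklore] -/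
theorem exists_walk_onRing_corner {M : ℕ} {z : Site 2} (hz : OnRing M z) :
    ∃ q : (zdGraph 2).Walk z (ringCorner M), ∀ v ∈ q.support, OnRing M v := by
  have key : ∀ {w : Site 2}, |w 0| = M → |w 1| ≤ M →
      ∃ q : (zdGraph 2).Walk w (ringCorner M), ∀ v ∈ q.support, OnRing M v := by
    intro w hw0 hw1
    -- up to the top, then (if on the left side) right along the top
    obtain ⟨t, q₁, ht0, ht1, hq₁⟩ := exists_walk_onRing_vertical hw0 hw1
    obtain ⟨t', q₂, ht'1, ht'0, hq₂⟩ := exists_walk_onRing_horizontal (M := M) (z := t) (by rw [ht1]; simp)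
      (by rw [ht0, hw0])
    have ht' : t' = ringCorner M := by
      funext i; fin_cases i
      · exact ht'0
      · change t' 1 = M; rw [ht'1, ht1]
    refine ⟨(q₁.append q₂).copy rfl ht', fun v hv => ?_⟩
    rw [Walk.support_copy, Walk.mem_support_append_iff] at hv
    rcases hv with hv | hv
    · exact hq₁ v hv
    · exact hq₂ v hv
  rcases hz with ⟨hz0, hz1⟩ | ⟨hz1, hz0⟩
  · exact key hz0 hz1
  · -- right along the row to the right side, then the previous case
    obtain ⟨t, q₁, ht1, ht0, hq₁⟩ := exists_walk_onRing_horizontal hz1 hz0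
    obtain ⟨q₂, hq₂⟩ := key (w := t) (by rw [ht0]; simp) (by rw [ht1, hz1])
    refine ⟨q₁.append q₂, fun v hv => ?_⟩
    rw [Walk.mem_support_append_iff] at hv
    rcases hv with hv | hv
    · exact hq₁ v hv
    · exact hq₂ v hv

/-- **The ring is lattice-connected.** [folklore] -/
theorem exists_walk_onRing {M : ℕ} {z w : Site 2} (hz : OnRing M z) (hw : OnRing M w) :
    ∃ q : (zdGraph 2).Walk z w, ∀ v ∈ q.support, OnRing M v := by
  obtain ⟨q₁, hq₁⟩ := exists_walk_onRing_corner hz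
  obtain ⟨q₂, hq₂⟩ := exists_walk_onRing_corner hw
  refine ⟨q₁.append q₂.reverse, fun v hv => ?_⟩
  rw [Walk.mem_support_append_iff, Walk.support_reverse, List.mem_reverse] at hv
  rcases hv with hv | hv
  · exact hq₁ v hv
  · exact hq₂ v hv

/-! ### Boxes, reflection and fold -/

/-- Box membership is invariant under the reflection. [folklore] -/
theorem mem_box_Rf_iff {m : ℕ} {z : Site 2} : Rf z ∈ box 2 m ↔ z ∈ box 2 m := by
  simp only [mem_box, Fin.forall_fin_two, Rf_apply_zero, Rf_apply_one]; omega

/-- Box membership is invariant under the fold. [folklore] -/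
theorem mem_box_foldSite_iff {m : ℕ} {z : Site 2} : foldSite z ∈ box 2 m ↔ z ∈ box 2 m := by
  simp only [mem_box, Fin.forall_fin_two, foldSite_apply_zero, foldSite_apply_one]
  rcases abs_cases (z 1) with ⟨h, h'⟩ | ⟨h, h'⟩
  · simp only [h]
  · simp only [h]; omega

/-- The reflection fixes the origin. [folklore] -/
theorem Rf_zero : Rf (0 : Site 2) = 0 := by
  funext i; fin_cases i
  · exact Rf_apply_zero 0
  · change Rf 0 1 = 0; rw [Rf_apply_one]; simp

/-- The ring is symmetric. [folklore] -/
theorem onRing_Rf_iff {M : ℕ} {z : Site 2} : OnRing M (Rf z) ↔ OnRing M z := by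
  unfold OnRing; rw [Rf_apply_zero, Rf_apply_one, abs_neg]

/-- A lattice step out of the box `Λ_N` lands on the ring `{‖x‖_∞ = N + 1}`. [folklore] -/
theorem onRing_of_adj_not_mem_box {N : ℕ} {u v : Site 2} (hu : u ∈ box 2 N) (huv : (zdGraph 2).Adj u v)
    (hv : v ∉ box 2 N) : OnRing (N + 1) v := by
  rw [mem_box, Fin.forall_fin_two] at hu hv
  unfold OnRing
  push_cast
  have habs : ∀ t : ℤ, -(N : ℤ) - 1 ≤ t → t ≤ N + 1 → ¬ (-(N : ℤ) ≤ t ∧ t ≤ N) → |t| = N + 1 := by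
    intro t h1 h2 h3; rw [abs_eq (by positivity)]; omega
  rcases (zdGraph_two_adj_iff u v).1 huv with ⟨h0, h1⟩ | ⟨h0, h1⟩ | ⟨h1, h0⟩ | ⟨h1, h0⟩
  · left; exact ⟨habs _ (by omega) (by omega) (fun h => hv ⟨h, by rw [h1]; exact hu.2⟩), by rw [h1, abs_le]; omega⟩
  · left; exact ⟨habs _ (by omega) (by omega) (fun h => hv ⟨h, by rw [h1]; exact hu.2⟩), by rw [h1, abs_le]; omega⟩
  · right; exact ⟨habs _ (by omega) (by omega) (fun h => hv ⟨by rw [h0]; exact hu.1, h⟩), by rw [h0, abs_le]; omega⟩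
  · right; exact ⟨habs _ (by omega) (by omega) (fun h => hv ⟨by rw [h0]; exact hu.1, h⟩), by rw [h0, abs_le]; omega⟩

/-- A border site of `Λ_N` has a ring neighbour. [folklore] -/
theorem exists_onRing_adj {N : ℕ} {z : Site 2} (hz : z ∈ box 2 N) (hzi : ∃ i, |z i| = N) :
    ∃ r, OnRing (N + 1) r ∧ (zdGraph 2).Adj z r := by
  rw [mem_box, Fin.forall_fin_two] at hz
  obtain ⟨i, hi⟩ := hzi
  fin_cases i
  · change |z 0| = N at hi
    rcases abs_eq (by positivity : (0 : ℤ) ≤ N) |>.1 hi with h | h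
    · refine ⟨z + Pi.single 0 1, ?_, Zhang.adj_add_unitStep.1 z⟩
      unfold OnRing; left; simp; constructor <;> [rw [abs_eq (by positivity)]; rw [abs_le]] <;> omega
    · refine ⟨z + -Pi.single 0 1, ?_, Zhang.adj_add_unitStep.2.1 z⟩
      unfold OnRing; left; simp; constructor <;> [rw [abs_eq (by positivity)]; rw [abs_le]] <;> omega
  · change |z 1| = N at hi
    rcases abs_eq (by positivity : (0 : ℤ) ≤ N) |>.1 hi with h | h
    · refine ⟨z + Pi.single 1 1, ?_, Zhang.adj_add_unitStep.2.2.1 z⟩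
      unfold OnRing; right; simp; constructor <;> [rw [abs_eq (by positivity)]; rw [abs_le]] <;> omega
    · refine ⟨z + -Pi.single 1 1, ?_, Zhang.adj_add_unitStep.2.2.2 z⟩
      unfold OnRing; right; simp; constructor <;> [rw [abs_eq (by positivity)]; rw [abs_le]] <;> omega

/-- A window site is not adjacent to the ring (`n < N`). [folklore] -/
theorem not_adj_onRing_of_mem_box {N n : ℕ} (hnN : n < N) {c r : Site 2} (hc : c ∈ box 2 n) (hr : OnRing (N + 1) r) :
    ¬ (zdGraph 2).Adj c r := by
  intro h
  rw [mem_box, Fin.forall_fin_two] at hc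
  unfold OnRing at hr; push_cast at hr
  rcases hr with ⟨hr0, hr1⟩ | ⟨hr1, hr0⟩ <;> rw [abs_eq (by positivity)] at * <;>
    rcases (zdGraph_two_adj_iff c r).1 h with ⟨h0, h1⟩ | ⟨h0, h1⟩ | ⟨h1, h0⟩ | ⟨h1, h0⟩ <;> omega

/-! ### The attached clusters and the set `C` -/

section Main

variable (N n : ℕ) (O : Set (Site 2))

/-- The upper half-annulus `(Λ_N ∖ Λ_n) ∩ {x₂ ≥ 0}`. [cite: GeorgiiHiguchi2000, §3 (half-planes)] -/
def annU : Set (Site 2) := {z | z ∈ box 2 N ∧ z ∉ box 2 n ∧ 0 ≤ z 1}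

/-- The symmetrised occupied set (pull-back of `O ∩ {x₂ ≥ 0}` along the fold). [folklore] -/
def Osym : Set (Site 2) := {z | foldSite z ∈ O}

/-- Unoccupied sites of the symmetric annulus. [folklore] -/
def Good (z : Site 2) : Prop := z ∈ box 2 N ∧ z ∉ box 2 n ∧ z ∉ Osym O

/-- Unoccupied annulus sites attached to the border by an unoccupied lattice walk. [folklore] -/
def Att : Set (Site 2) :=
  {z | Good N n O z ∧ ∃ (b : Site 2) (w : (zdGraph 2).Walk z b), (∃ i, |b i| = N) ∧ ∀ v ∈ w.support, Good N n O v}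

/-- The set `C`: the ring `{‖x‖_∞ = N+1}` together with the attached clusters. [folklore] -/
def Cset : Finset (Site 2) := by
  classical exact (box 2 (N + 1)).filter fun z => OnRing (N + 1) z ∨ z ∈ Att N n O

variable {N n O}

/-- Membership in `C`. [folklore] -/
theorem mem_Cset_iff {z : Site 2} : z ∈ Cset N n O ↔ OnRing (N + 1) z ∨ z ∈ Att N n O := by
  classical
  unfold Cset
  rw [mem_filter, and_iff_right_iff_imp]
  rintro (h | h)
  · rw [mem_box]; intro i
    unfold OnRing at h
    rcases h with ⟨h0, h1⟩ | ⟨h1, h0⟩ <;> fin_cases i <;> simp <;> rw [abs_le] at * <;>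
      first | omega | (rw [abs_eq (by positivity)] at *; omega)
  · have := mem_box.1 h.1.1
    rw [mem_box]; intro i; have := this i; push_cast; omega

/-- Attached walks consist of attached sites. [folklore] -/
theorem mem_Att_of_mem_support {z b v : Site 2} (w : (zdGraph 2).Walk z b) (hb : ∃ i, |b i| = N)
    (hw : ∀ u ∈ w.support, Good N n O u) (hv : v ∈ w.support) : v ∈ Att N n O :=
  ⟨hw v hv, b, w.dropUntil v hv, hb, fun u hu => hw u (Walk.support_dropUntil_subset_support w hv hu)⟩

/-- A good neighbour of an attached site is attached. [folklore] -/
theorem mem_Att_of_adj {y a : Site 2} (hy : Good N n O y) (hya : (zdGraph 2).Adj y a) (ha : a ∈ Att N n O) :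
    y ∈ Att N n O := by
  obtain ⟨-, b, w, hb, hw⟩ := ha
  refine ⟨hy, b, Walk.cons hya w, hb, fun v hv => ?_⟩
  rw [Walk.support_cons, List.mem_cons] at hv
  rcases hv with rfl | hv
  · exact hy
  · exact hw v hv

/-- `Good` is symmetric. [folklore] -/
theorem good_Rf_iff {z : Site 2} : Good N n O (Rf z) ↔ Good N n O z := by
  unfold Good Osym; rw [mem_box_Rf_iff, mem_box_Rf_iff, Set.mem_setOf_eq, Set.mem_setOf_eq, foldSite_Rf]

/-- `Att` is symmetric. [folklore] -/
theorem Rf_mem_Att {z : Site 2} (hz : z ∈ Att N n O) : Rf z ∈ Att N n O := by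
  obtain ⟨hg, b, w, ⟨i, hi⟩, hw⟩ := hz
  refine ⟨good_Rf_iff.2 hg, Rf b, w.map (reflectCoord (d := 2) 1).toHom, ⟨i, ?_⟩, fun v hv => ?_⟩
  · fin_cases i
    · change |Rf b 0| = N; rw [Rf_apply_zero]; exact hi
    · change |Rf b 1| = N; rw [Rf_apply_one, abs_neg]; exact hi
  · obtain ⟨y, hy, rfl⟩ := (mem_support_map_iff' _ w v).1 hv
    exact good_Rf_iff.2 (hw y hy)

/-- `C` is symmetric. [folklore] -/
theorem Rf_mem_Cset {z : Site 2} (hz : z ∈ Cset N n O) : Rf z ∈ Cset N n O := by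
  rw [mem_Cset_iff] at hz ⊢
  rcases hz with h | h
  · exact Or.inl (onRing_Rf_iff.2 h)
  · exact Or.inr (Rf_mem_Att h)

/-- `C` is symmetric (iff form). [folklore] -/
theorem Rf_mem_Cset_iff {z : Site 2} : Rf z ∈ Cset N n O ↔ z ∈ Cset N n O :=
  ⟨fun h => by simpa [Rf_Rf] using Rf_mem_Cset h, Rf_mem_Cset⟩

/-- The visible boundary notions are symmetric: `LVis`. [folklore] -/
theorem Rf_mem_LVis {y : Site 2} (hy : y ∈ LVis (Cset N n O) 0) : Rf y ∈ LVis (Cset N n O) 0 := by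
  obtain ⟨hyC, ⟨c, hc, hyc⟩, w, hw⟩ := hy
  refine ⟨fun h => hyC (Rf_mem_Cset_iff.1 h), ⟨Rf c, Rf_mem_Cset hc, (reflectCoord (d := 2) 1).map_rel_iff.2 hyc⟩,
    (w.map (reflectCoord (d := 2) 1).toHom).copy Rf_zero rfl, fun v hv => ?_⟩
  rw [Walk.support_copy] at hv
  obtain ⟨u, hu, rfl⟩ := (mem_support_map_iff' _ w v).1 hv
  exact fun h => hw u hu (Rf_mem_Cset_iff.1 h)

/-- The visible boundary notions are symmetric: `LOutVis`. [folklore] -/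
theorem Rf_mem_LOutVis {y : Site 2} (hy : y ∈ LOutVis (Cset N n O) 0) : Rf y ∈ LOutVis (Cset N n O) 0 := by
  obtain ⟨hyV, w, hwC, hwV⟩ := hy
  refine ⟨Rf_mem_LVis hyV, (w.map (reflectCoord (d := 2) 1).toHom).copy Rf_zero rfl, fun v hv => ?_, fun v hv hvy => ?_⟩
  · rw [Walk.support_copy] at hv
    obtain ⟨u, hu, rfl⟩ := (mem_support_map_iff' _ w v).1 hv
    exact fun h => hwC u hu (Rf_mem_Cset_iff.1 h)
  · rw [Walk.support_copy] at hv
    obtain ⟨u, hu, rfl⟩ := (mem_support_map_iff' _ w v).1 hv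
    intro h
    have hu' : u ≠ y := fun e => hvy (by rw [e]; rfl)
    exact hwV u hu hu' (by simpa [Rf_Rf] using Rf_mem_LVis h)

/-! ### The duality theorem -/

/-- **Half-annulus duality** (finite form of "no `+`lattice escape ⇒ `−∗`semicircuit", Russo 1979 /
Georgii–Higuchi 2000): for `n < N` and any set `O` of occupied sites, either some unoccupied lattice
walk in the upper half-annulus `(Λ_N ∖ Λ_n) ∩ {x₂ ≥ 0}` joins a site adjacent to the window `Λ_n` to
the border layer `{|x_i| = N}`, or some occupied `∗`-walk in the upper half-annulus joins the left
half-axis `{x₂ = 0, x₁ < -n}` to the right half-axis `{x₂ = 0, x₁ > n}`. [cite: GeorgiiHiguchi2000, Lemma 5.5 Case 1 and Lemma 3.4 (proofs)] -/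
theorem exists_starSemicircuit_or_latticeEscape (hnN : n < N) (O : Set (Site 2)) :
    (∃ (a b : Site 2) (w : (zdGraph 2).Walk a b), (∃ c ∈ box 2 n, (zdGraph 2).Adj a c) ∧ (∃ i, |b i| = N) ∧
        ∀ v ∈ w.support, v ∈ annU N n ∧ v ∉ O) ∨
    (∃ (a b : Site 2) (q : zdStarGraph.Walk a b), a 1 = 0 ∧ b 1 = 0 ∧ a 0 < -(n : ℤ) ∧ (n : ℤ) < b 0 ∧
        ∀ v ∈ q.support, v ∈ annU N n ∧ v ∈ O) := by
  classical
  by_cases hesc : ∃ (a b : Site 2) (w : (zdGraph 2).Walk a b), (∃ c ∈ box 2 n, (zdGraph 2).Adj a c) ∧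
      (∃ i, |b i| = N) ∧ ∀ v ∈ w.support, v ∈ annU N n ∧ v ∉ O
  · exact Or.inl hesc
  right
  set C := Cset N n O with hCdef
  -- (L5) window sites are not adjacent to attached sites
  have hwinAtt : ∀ c ∈ box 2 n, ∀ a ∈ Att N n O, ¬ (zdGraph 2).Adj c a := by
    intro c hc a ha hca
    obtain ⟨hga, b, w, ⟨i, hi⟩, hw⟩ := ha
    apply hesc
    refine ⟨foldSite a, foldSite b, w.map latticeFoldHom, ⟨foldSite c, mem_box_foldSite_iff.2 hc, ?_⟩, ⟨i, ?_⟩,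
      fun v hv => ?_⟩
    · exact latticeFoldHom.map_rel hca.symm
    · fin_cases i
      · change |foldSite b 0| = N; rw [foldSite_apply_zero]; exact hi
      · change |foldSite b 1| = N; rw [foldSite_apply_one, abs_abs]; exact hi
    · obtain ⟨u, hu, rfl⟩ := (mem_support_map_iff' _ w v).1 hv
      obtain ⟨hu1, hu2, hu3⟩ := hw u hu
      change foldSite u ∈ annU N n ∧ foldSite u ∉ O
      exact ⟨⟨mem_box_foldSite_iff.2 hu1, fun h => hu2 (mem_box_foldSite_iff.1 h), by
        rw [foldSite_apply_one]; exact abs_nonneg _⟩, hu3⟩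
  -- (L6) `C` is lattice-connected
  have hring : ∀ r, OnRing (N + 1) r → r ∈ C := fun r hr => mem_Cset_iff.2 (Or.inl hr)
  have hAttring : ∀ a ∈ Att N n O, ∃ (r : Site 2) (q : (zdGraph 2).Walk a r), OnRing (N + 1) r ∧ ∀ v ∈ q.support, v ∈ C := by
    intro a ha
    obtain ⟨hga, b, w, hb, hw⟩ := ha
    obtain ⟨r, hr, hbr⟩ := exists_onRing_adj (hw b (Walk.end_mem_support w)).1 hb
    refine ⟨r, w.append (Walk.cons hbr Walk.nil), hr, fun v hv => ?_⟩
    rw [Walk.mem_support_append_iff, Walk.support_cons, Walk.support_nil, List.mem_cons, List.mem_singleton] at hv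
    rcases hv with hv | hv | hv
    · exact mem_Cset_iff.2 (Or.inr (mem_Att_of_mem_support w hb hw hv))
    · rw [hv]; exact mem_Cset_iff.2 (Or.inr (mem_Att_of_mem_support w hb hw (Walk.end_mem_support w)))
    · rw [hv]; exact hring r hr
  have hCconn : ∀ a ∈ C, ∀ b ∈ C, ∃ q : (zdGraph 2).Walk a b, ∀ z ∈ q.support, z ∈ C := by
    -- every `C`-site is joined inside `C` to a ring site; ring sites are joined inside the ring
    have htoRing : ∀ a ∈ C, ∃ (r : Site 2) (q : (zdGraph 2).Walk a r), OnRing (N + 1) r ∧ ∀ v ∈ q.support, v ∈ C := by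
      intro a ha
      rcases mem_Cset_iff.1 ha with h | h
      · exact ⟨a, Walk.nil, h, fun v hv => by rw [Walk.support_nil, List.mem_singleton] at hv; exact hv ▸ ha⟩
      · exact hAttring a h
    intro a ha b hb
    obtain ⟨r, q₁, hr, hq₁⟩ := htoRing a ha
    obtain ⟨r', q₂, hr', hq₂⟩ := htoRing b hb
    obtain ⟨q₃, hq₃⟩ := exists_walk_onRing hr hr'
    refine ⟨(q₁.append q₃).append q₂.reverse, fun z hz => ?_⟩
    rw [Walk.mem_support_append_iff, Walk.mem_support_append_iff, Walk.support_reverse, List.mem_reverse] at hz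
    rcases hz with (hz | hz) | hz
    · exact hq₁ z hz
    · exact hring z (hq₃ z hz)
    · exact hq₂ z hz
  -- (L7) the origin is outside `C` and not adjacent to it
  have h0n : (0 : Site 2) ∈ box 2 n := by rw [mem_box]; intro i; simp
  have h0C : (0 : Site 2) ∉ C := by
    intro h
    rcases mem_Cset_iff.1 h with h | h
    · unfold OnRing at h; simp at h; omega
    · exact h.1.2.1 h0n
  have h0adj : ∀ c ∈ C, ¬ (zdGraph 2).Adj 0 c := by
    intro c hc
    rcases mem_Cset_iff.1 hc with h | h
    · exact not_adj_onRing_of_mem_box hnN h0n h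
    · exact hwinAtt 0 h0n c h
  -- (L8) walks from the origin avoiding `C` stay in `Λ_N`
  have hstay : ∀ {b : Site 2} (w : (zdGraph 2).Walk 0 b), (∀ v ∈ w.support, v ∉ C) → ∀ v ∈ w.support, v ∈ box 2 N := by
    have hN0 : (0 : Site 2) ∈ box 2 N := by rw [mem_box]; intro i; simp
    suffices H : ∀ {a b : Site 2} (w : (zdGraph 2).Walk a b), a ∈ box 2 N → (∀ v ∈ w.support, v ∉ C) →
        ∀ v ∈ w.support, v ∈ box 2 N from fun {b} w hw => H w hN0 hw
    intro a b w
    induction w with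
    | nil => intro ha _ v hv; rw [Walk.support_nil, List.mem_singleton] at hv; exact hv ▸ ha
    | cons hadj w ih =>
      rename_i u v' t
      intro hu hw z hz
      have hv' : v' ∈ box 2 N := by
        by_contra hv'
        exact hw v' (by simp) (hring v' (onRing_of_adj_not_mem_box hu hadj hv'))
      rw [Walk.support_cons, List.mem_cons] at hz
      rcases hz with rfl | hz
      · exact hu
      · exact ih hv' (fun x hx => hw x (by rw [Walk.support_cons]; exact List.mem_cons_of_mem _ hx)) z hz
  -- (L9) visible sites are occupied annulus sites
  have hvis : ∀ y ∈ LOutVis C 0, y ∈ box 2 N ∧ y ∉ box 2 n ∧ y ∈ Osym O := by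
    intro y hy
    obtain ⟨⟨hyC, ⟨c, hc, hyc⟩, w, hw⟩, -⟩ := hy
    have hyN : y ∈ box 2 N := hstay w hw y (Walk.end_mem_support w)
    rcases mem_Cset_iff.1 hc with hcr | hca
    · -- adjacent to the ring: a border site, not in the window, occupied (else attached)
      have hyn : y ∉ box 2 n := fun h => not_adj_onRing_of_mem_box hnN h hcr hyc
      refine ⟨hyN, hyn, ?_⟩
      by_contra hyO
      have hyi : ∃ i, |y i| = N := by
        rw [mem_box, Fin.forall_fin_two] at hyN
        unfold OnRing at hcr; push_cast at hcr
        rcases hcr with ⟨hr0, hr1⟩ | ⟨hr1, hr0⟩ <;> rw [abs_eq (by positivity)] at * <;>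
          rcases (zdGraph_two_adj_iff y c).1 hyc with ⟨h0, h1⟩ | ⟨h0, h1⟩ | ⟨h1, h0⟩ | ⟨h1, h0⟩ <;>
          first
          | exact ⟨0, by rw [abs_eq (by positivity)]; omega⟩
          | exact ⟨1, by rw [abs_eq (by positivity)]; omega⟩
      exact hyC (mem_Cset_iff.2 (Or.inr ⟨⟨hyN, hyn, hyO⟩, y, Walk.nil, hyi, fun v hv => by
        rw [Walk.support_nil, List.mem_singleton] at hv; exact hv ▸ ⟨hyN, hyn, hyO⟩⟩))
    · have hyn : y ∉ box 2 n := fun h => hwinAtt y h c hca hyc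
      refine ⟨hyN, hyn, ?_⟩
      by_contra hyO
      exact hyC (mem_Cset_iff.2 (Or.inr (mem_Att_of_adj ⟨hyN, hyn, hyO⟩ hyc hca)))
  -- (L11) the visible axis sites on both sides
  have haxis : ∀ (s : Site 2) (hs : ∀ x : Site 2, (zdGraph 2).Adj x (x + s)), s 1 = 0 → (s 0 = 1 ∨ s 0 = -1) →
      ∃ z ∈ LOutVis C 0, z 1 = 0 ∧ (n : ℤ) < s 0 * z 0 := by
    intro s hs hs1 hs0
    set e := (fun w : Site 2 => w + s)^[N + 1] 0 with he
    have he0 : e 0 = (N + 1 : ℕ) * s 0 := by rw [he, Zhang.iterate_add_apply]; simp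
    have he1 : e 1 = 0 := by rw [he, Zhang.iterate_add_apply]; simp [hs1]
    have heabs : |e 0| = N + 1 := by
      rw [he0]; rcases hs0 with h | h <;> rw [h] <;> push_cast <;> rw [abs_eq (by positivity)]
      · left; ring
      · right; ring
    have heC : e ∈ C := hring e (by
      unfold OnRing; left
      refine ⟨by rw [heabs]; push_cast; ring, by rw [he1]; simp; positivity⟩)
    obtain ⟨z, hzw, hzV, -⟩ := exists_mem_LOutVis_of_walk (C := C) (x₀ := 0) h0C heC (Zhang.stepRun s hs 0 (N + 1))
    rw [Zhang.mem_support_stepRun] at hzw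
    obtain ⟨j, hj, hz0, hz1⟩ := hzw
    simp [hs1] at hz0 hz1
    refine ⟨z, hzV, hz1, ?_⟩
    have hzn : ¬ (-(n : ℤ) ≤ z 0 ∧ z 0 ≤ n) := by
      intro h; apply (hvis z hzV).2.1
      rw [mem_box, Fin.forall_fin_two, hz1]; exact ⟨h, by omega⟩
    rw [hz0] at hzn ⊢
    rcases hs0 with h | h <;> rw [h] at hzn ⊢ <;> simp at hzn ⊢ <;> omega
  obtain ⟨zR, hzRV, hzR1, hzR0⟩ := haxis (Pi.single 0 1) Zhang.adj_add_unitStep.1 (by simp) (by simp)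
  obtain ⟨zL, hzLV, hzL1, hzL0⟩ := haxis (-Pi.single 0 1) Zhang.adj_add_unitStep.2.1 (by simp) (by simp)
  simp at hzR0 hzL0
  -- (L12) the Deuschel–Pisztora walk, folded
  obtain ⟨q, hq⟩ := exists_starWalk_latticeBoundary (C := C) (x₀ := 0) hCconn h0C h0adj hzLV hzRV
  refine ⟨zL, zR, (q.map starFoldHom).copy (foldSite_of_nonneg hzL1.ge) (foldSite_of_nonneg hzR1.ge),
    hzL1, hzR1, by linarith, hzR0, fun v hv => ?_⟩
  rw [Walk.support_copy] at hv
  obtain ⟨y, hy, rfl⟩ := (mem_support_map_iff' _ q v).1 hv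
  have hyV := hq y hy
  have hfV : foldSite y ∈ LOutVis C 0 := by
    rcases foldSite_eq_or y with h | h <;> rw [h]
    · exact hyV
    · exact Rf_mem_LOutVis hyV
  obtain ⟨h1, h2, h3⟩ := hvis _ hfV
  change foldSite y ∈ annU N n ∧ foldSite y ∈ O
  refine ⟨⟨h1, h2, by rw [foldSite_apply_one]; exact abs_nonneg _⟩, ?_⟩
  have : foldSite (foldSite y) ∈ O := h3
  rwa [foldSite_foldSite] at this

end Main

end Literature.Probability.Percolation
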